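import Literature.MathematicalPhysics.QuantumFieldTheory.Balaban1983to89.B2Ineq2109HiggsLattice
import Literature.MathematicalPhysics.QuantumFieldTheory.Balaban1983to89.B2Eq246ScalarStep

/-!
# `Balaban1983to89.B2Eq2108HkOperator` — T. Bałaban, *(Higgs)₂,₃ quantum fields in a finite volume. II. An upper bound*,
Commun. Math. Phys. **86** (1982) 555–594 [Balaban1982Higgs2] p. 580 [PDF 26], **(2.108): the operator `H_k` AS A LINEAR
OPERATOR ON THE FIELDS OF `T⁽ᵏ⁾` and the splitting (2.108) IN THE SCALAR-PRODUCT CURRENCY (I.1.5) of the (Higgs)₂,₃ carrier**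
— the dictionary between p23 g15's coordinate matrix `B2Ineq2109HiggsLattice.Inst.Hk` (on `X = Λ₆^{(k−1)′} × {1,…,N}`, the
object for which (2.109)/(3.8) is PROVED, `B2Ineq2109HiggsLattice`/`B2Ineq2109HiggsLatticeTower`) and the form
`½⟨Λ₆^{(k−1)′}φ, H_kΛ₆^{(k−1)′}φ⟩` as print writes it in (2.108), (3.5), (3.7) (the typer's `siteInner`, p23 g25's `Data37.hForm37`):
`HkOp` (with body), `siteInner_HkOp` and **`eq2108_siteInner`**

statement-level skeleton of published theorems with citation tags; proofs where landed; nothing here is a claim about the Yang–Mills mass gap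

PDF held: `paper:balaban1982-cmp86-higgs23-ii` (journal page = PDF page + 554); p. 580 [PDF 26] as read (image) for
`B2Ineq2109HiggsLattice` (p23 g15; render `…/1982-cmp86-higgs23-II-p026-x2.png` of the b2b reference pages); nothing is
re-read here.

CITATION HEADER (lean-in-tree rule).  lit-balaban typed skeleton (HOME `run/shared/lean/pub/lit-balaban/`), Phase-2 proof
seat **p23** gen 26 (unit `lit-balaban-p23-g26`; TAKING #2 line HOME/STATUS.md).  SKELETON rows **B2.Eq2.109** ((2.108)–(2.109)
p. 580; owner r02; head `proved p325417 · …`, the (2.108) objects of record = p23 g15 `B2Ineq2109HiggsLattice.Inst`) and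
**B2.Eq3.1-3.10** ((3.5)/(3.7) carry `½⟨Λ₆^{(k−1)′}φ_k, H_kΛ₆^{(k−1)′}φ_k⟩`; p. 584: *"we have applied formula (2.108) together with the
remark following it to the expression in the exponent in (3.5)"*) — CELLS ONLY, no head change claimed.  USED BY NAME, NOTHING
RESTATED: p23 g15's `B2Ineq2109HiggsLattice.Inst.{reg, Ω, Ω₁, Ω₂, DΩ, D1, D2, MΩ, MPP, MP34, M34P, M33, Hk, eq2108_split,
eq2108_split_printed}`, p35's `B1Eq230FluctCov.{deltaKA, mat, cb, mat_mulVec, siteInner_eq_dotProduct, Ix}` ((I.2.21), the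
coordinate matrix of a linear operator and (I.1.5) in coordinates), p34's `B1Eq221Coordinates.{fieldCoord, fieldCoord_apply,
siteCoord}` (p. 605 coordinates), the typer's `HiggsLattice.siteInner`, `B2Eq255Concrete.cutTo` and
`B2Eq246ScalarStep.fieldCoord_cutTo_apply` (coordinates of a cut field).

THE SOURCE TEXT (p. 580 [PDF 26], verbatim, exactly as transcribed in `B2Ineq2109HiggsLattice` l. 41–49 from the render; v1.1
restores the printed words, referee ref-4 D-g79-1 / second reader r14 v63): *"We have ½aL^{d−2}Σ_{y∈T₁^{(k)′}}|ψ(y) − (Q(θ_kB̃)φ)(y)|²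
+ ½⟨(Λ₆^{(k−1)′}∩Λ₃^{(k)c})φ, Δ^{(k)}(B^k(Λ₂^{(k−1)′}∩Λ₅^{(k)c}), B̃)(Λ₆^{(k−1)′}∩Λ₃^{(k)c})φ⟩ + ⟨(Λ₆^{(k−1)′}∩Λ₃^{(k)c})φ,
Δ^{(k)}(B^k(Λ₂^{(k−1)′}∩Λ₅^{(k)c}), B̃)(Λ₃^{(k)}∩Λ₄^{(k)c})φ⟩ + ⟨Λ₃^{(k)}φ, Δ^{(k)}(B^k(Λ₂^{(k)}), B^{(k+1),η})Λ₃^{(k)}φ⟩ + O((Lᵏε)^κ)|Λ₃^{(k)}|.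
(2.108)  More exactly the difference between the quadratic forms is a quadratic form ½⟨Λ₆^{(k−1)′}φ, H_kΛ₆^{(k−1)′}φ⟩ and for the
matrix elements h_k(x, x′) of the operator H_k of this form, the following inequality holds"* [(2.109) follows; the fourth term is
printed without the factor `½`, read corrected as in cell GAPS.md G-B2-08].  READING (declared; it is p23 g15's `Inst.eq2108_split` and
is confirmed by (3.7) p. 584 lines 4–5): print displays the transformed EXPRESSION with no left-hand side; the "quadratic forms" whose
difference defines `H_k` are the basic form `½⟨Λ₆^{(k−1)′}φ, Δ^{(k)}(B^k(Λ₂^{(k−1)′}), B̃)Λ₆^{(k−1)′}φ⟩` ((2.87) p. 575, before the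
localization) and the sum of the three localized forms of (2.108) (the `ψ`-term is carried along unchanged), i.e.
`½⟨Λ₆′φ, Δ^{(k)}(B^k(Λ₂′), B̃)Λ₆′φ⟩ = ½⟨(Λ₆′∩Λ₃ᶜ)φ, …(Λ₆′∩Λ₃ᶜ)φ⟩ + ⟨(Λ₆′∩Λ₃ᶜ)φ, …(Λ₃∩Λ₄ᶜ)φ⟩ + ½⟨Λ₃φ, …Λ₃φ⟩ + ½⟨Λ₆′φ, H_kΛ₆′φ⟩`
— the equation shape used below.  p. 584 (3.7): *"+ ½⟨Λ₆^{(k−1)′}φ_k, H_kΛ₆^{(k−1)′}φ_k⟩ … Also we have applied formula (2.108)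
together with the remark following it to the expression in the exponent in (3.5)."*  Part I p. 604 (1.5):
`⟨f, g⟩ = Σ_{x∈T^{(k)}}(Lᵏε)ᵈ f(x)·g(x)`.

DICTIONARY.  p23 g15 typed (2.108) as an identity of COORDINATE quadratic forms on `X = Λ₆^{(k−1)′} × {1,…,N}`: `MΩ` = the
entries of the typer's coordinate matrix `mat Δ^{(k),Lᵏε}(Ω, B̃)` on `X`, `MPP`/`MP34`/`M34P`/`M33` the three localized forms
(masks `Λ₆′∩Λ₃ᶜ`, `Λ₃∩Λ₄ᶜ`, `Λ₃` as index conditions), `Hk := MΩ − MPP − MP34 − M34P − M33`.  Print's `H_k` is an OPERATOR on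
the fields of `T⁽ᵏ⁾` inside the scalar product (I.1.5): here `HkOp` := the linear operator whose coordinate matrix is `Hk`
extended by zero off `Λ₆^{(k−1)′}` (`Module` basis `cb` of p35), so that `⟨f, HkOp g⟩ = (Lᵏε)ᵈ·Σ_{p,q∈X} f̂(p)·Hk(p,q)·ĝ(q)`
(`siteInner_HkOp`) — the weight `(Lᵏε)ᵈ` being (I.1.5)'s (p35's `siteInner_eq_dotProduct`).

WHAT IS PROVED (kernel-checked, 0 `sorry`, standard axioms; DEFINITIONS WITH BODY (`extL6`, `HkFull`, `HkOp`, `crdL6`) +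
theorems; NO `Prop`-valued fact).
 §1 (coordinates of cut fields = the typer's `B2Eq246ScalarStep.fieldCoord_cutTo_apply`, BY NAME); the restriction `crdL6` of the
    coordinates to `X` and
    **`siteInner_cutTo_op_cutTo`**: `⟨Aφ, T(Bψ)⟩ = (Lᵏε)ᵈ·Σ_{p,q∈X}[p∈A]φ̂(p)·(mat T)(p,q)·[q∈B]ψ̂(q)` for masks `A, B ⊆ Λ₆′` and ANY
    linear operator `T` (`sum_prod_eq_sum_sub`: sums over `T⁽ᵏ⁾ × Ix` of functions vanishing off `Λ₆′` are sums over `X`).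
 §2 `extL6`/`HkFull`/**`HkOp`**, `mat_HkOp`, **`siteInner_HkOp`**, `siteInner_cutTo_HkOp_cutTo` (the form `⟨Λ₆′φ, H_kΛ₆′φ⟩` IS
    g15's coordinate form times `(Lᵏε)ᵈ`).
 §3 the four forms of (2.108) in the (I.1.5) currency = g15's coordinate forms times `(Lᵏε)ᵈ`: `form_MΩ_eq`, `form_MPP_eq`,
    `form_MP34_eq`, `form_M33_eq`; hence **`eq2108_siteInner`**:
    `⟨Λ₆′φ, Δ⁽ᵏ⁾(Ω,B̃)Λ₆′φ⟩ = ⟨Pφ, Δ⁽ᵏ⁾(Ω₁,B̃)Pφ⟩ + 2⟨Pφ, Δ⁽ᵏ⁾(Ω₁,B̃)(Λ₃∖Λ₄)φ⟩ + ⟨Λ₃φ, Δ⁽ᵏ⁾(Ω₂,B̃)Λ₃φ⟩ + ⟨Λ₆′φ, H_kΛ₆′φ⟩`, `P = Λ₆′∖Λ₃`,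
    and **`eq2108_siteInner_half`** (the printed halves: (3.5)'s three scalar operator lines versus (3.7)'s lines 4–5:
    `−½⟨Λ₆′φ, ΔΛ₆′φ⟩ + ½⟨Λ₆′φ, H_kΛ₆′φ⟩ = −½⟨Pφ, Δ(Ω₁)Pφ⟩ − ⟨Pφ, Δ(Ω₁)(Λ₃∖Λ₄)φ⟩ − ½⟨Λ₃φ, Δ(Ω₂)Λ₃φ⟩`).
HONEST SCOPE.  (a) Pure dictionary/algebra over g15's objects: every analytic statement about `H_k` ((2.109)/(3.8), the error
term `O((Lᵏε)^κ)|Λ₃^{(k)}|`) stays where it is proved (`B2Ineq2109HiggsLattice`, `B2Eq2108ErrorHiggsLattice`, `…Tower`) and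
transfers through `siteInner_HkOp`.  (b) As in g15, ONE field `B̃ = i.A` serves all three operators (print's `B^{(k+1),η}` in the
`Λ₃`-term coincides with `B̃` on `Bᵏ(Λ₂^{(k)})`, where `θ_{k+1} = 1`; in (3.5) the same slot carries `Ã^{(k+1),ε}` = `Ã^{(k),ε}` there
by (3.4)) — that identification of fields is g15's reading, not re-derived.  (c) `HkOp` vanishes off `Λ₆^{(k−1)′} × {1,…,N}` by
construction (print only ever uses `H_k` between `Λ₆′`-cut fields).  (d) The masks of (2.108) live inside `Λ₆′` (`Λ₃ ⊆ Λ₆′`,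
g15's `h36`).  Value = the operator `H_k` of (2.108)/(3.5)/(3.7) available on the carrier's fields with (2.108) as an identity
of (I.1.5)-forms, so that (3.7)'s datum `Data37.Hk` can be the object of record; NOT summit progress.  No head change (owner r02).

VERSIONS.  v1.0 p372420 ✓ 041698800e59 (p23 gen 26).  v1.1 (p23 gen 26): DOC-ONLY — the p. 580 quotation restored to the
printed words and the equation-shape READING declared as such (ref-4 D-g79-1, r14 v63); every declaration byte-identical to v1.0.
-/

noncomputable section

open scoped BigOperators Matrix

namespace Literature.MathematicalPhysics.QuantumFieldTheory.Balaban1983to89.B2Eq2108HkOperator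

open HiggsLattice HiggsAveraging HiggsCovariance B1Eq221Coordinates B1Eq230FluctCov B2Eq255Concrete B2Ineq2109HiggsLattice
open B2Eq246ScalarStep (fieldCoord_cutTo_apply)
open Matrix

variable {P : HiggsLattice.Params} {N : ℕ}

/-! ## §1 Coordinates of cut fields; sums over `X = Λ₆^{(k−1)′} × {1,…,N}` -/

section Coordinates

variable {k : ℕ}

/-- A sum over `T⁽ᵏ⁾ × Ix` of a function vanishing off `S × Ix` is the sum over the subtype `↥S × Ix` (the index type `X` of
p23 g15's matrices). [cite: Balaban1982Higgs2, (2.108) p.580] [folklore] -/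
theorem sum_prod_eq_sum_sub (S : Finset (HiggsLattice.Site P k)) (F : HiggsLattice.Site P k × Ix N → ℝ)
    (hF : ∀ p, p.1 ∉ S → F p = 0) :
    ∑ p, F p = ∑ p : ↥S × Ix N, F (p.1.1, p.2) := by
  classical
  have h1 : ∑ x ∈ S, (∑ c, F (x, c)) = ∑ x, ∑ c, F (x, c) :=
    Finset.sum_subset (Finset.subset_univ S) (fun x _ hx => Finset.sum_eq_zero fun c _ => hF (x, c) hx)
  calc ∑ p, F p = ∑ x, ∑ c, F (x, c) := Fintype.sum_prod_type _
    _ = ∑ x ∈ S, ∑ c, F (x, c) := h1.symm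
    _ = ∑ x : ↥S, ∑ c, F (x.1, c) := (Finset.sum_coe_sort S _).symm
    _ = ∑ p : ↥S × Ix N, F (p.1.1, p.2) := (Fintype.sum_prod_type (fun p : ↥S × Ix N => F (p.1.1, p.2))).symm

variable (i : Inst P N)

/-- **The restriction of the coordinates of a field to `X = Λ₆^{(k−1)′} × {1,…,N}`** (the vectors on which g15's matrices
`MΩ, MPP, MP34, M33, Hk` act). [cite: Balaban1982Higgs2, (2.108) p.580] -/
def crdL6 (φ : ScalarField P (i.j + 1) N) : ↥i.L6 × Ix N → ℝ :=
  fun p => fieldCoord (E N) (HiggsLattice.Site P (i.j + 1)) φ (p.1.1, p.2)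

/-- `crdL6` unfolded (definitional). [cite: Balaban1982Higgs2, (2.108) p.580] -/
theorem crdL6_apply (φ : ScalarField P (i.j + 1) N) (p : ↥i.L6 × Ix N) :
    crdL6 i φ p = fieldCoord (E N) (HiggsLattice.Site P (i.j + 1)) φ (p.1.1, p.2) := rfl

/-- **The (I.1.5) form of a linear operator between fields cut to masks inside `Λ₆′`, in g15's coordinates**: for `A, B ⊆ Λ₆′`
and any linear `T` on the fields of `T⁽ᵏ⁾`,
`⟨Aφ, T(Bψ)⟩ = (Lᵏε)ᵈ · Σ_{p∈X} Σ_{q∈X} [p₁∈A]φ̂(p) · (mat T)(p, q) · [q₁∈B]ψ̂(q)`. [cite: Balaban1982Higgs1, (1.5) p.604] [cite: Balaban1982Higgs2, (2.108) p.580] -/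
theorem siteInner_cutTo_op_cutTo {A B : Finset (HiggsLattice.Site P (i.j + 1))} (hA : A ⊆ i.L6) (hB : B ⊆ i.L6)
    (T : ScalarField P (i.j + 1) N →ₗ[ℝ] ScalarField P (i.j + 1) N) (φ ψ : ScalarField P (i.j + 1) N) :
    siteInner (cutTo A φ) (T (cutTo B ψ))
      = P.mesh (i.j + 1) ^ P.d *
          ∑ p : ↥i.L6 × Ix N, ∑ q : ↥i.L6 × Ix N,
            (if p.1.1 ∈ A then crdL6 i φ p else 0) * mat T (p.1.1, p.2) (q.1.1, q.2)
              * (if q.1.1 ∈ B then crdL6 i ψ q else 0) := by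
  classical
  rw [siteInner_eq_dotProduct, ← mat_mulVec]
  congr 1
  simp only [dotProduct, Matrix.mulVec, fieldCoord_cutTo_apply, crdL6_apply]
  rw [sum_prod_eq_sum_sub i.L6 _ (fun p hp => by
    have hpA : p.1 ∉ A := fun h => hp (hA h)
    simp [hpA])]
  refine Finset.sum_congr rfl fun p _ => ?_
  dsimp only
  rw [Finset.mul_sum]
  rw [sum_prod_eq_sum_sub i.L6 _ (fun q hq => by
    have hqB : q.1 ∉ B := fun h => hq (hB h)
    simp [hqB])]
  refine Finset.sum_congr rfl fun q _ => ?_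
  dsimp only
  ring

end Coordinates

/-! ## §2 `H_k` as a linear operator on the fields of `T⁽ᵏ⁾` -/

section Operator

variable (i : Inst P N) (a : ℝ)

/-- A matrix on `X = Λ₆^{(k−1)′} × {1,…,N}` extended by zero to all coordinates of `T⁽ᵏ⁾`. [cite: Balaban1982Higgs2, (2.108) p.580] -/
def extL6 (M : Matrix (↥i.L6 × Ix N) (↥i.L6 × Ix N) ℝ) :
    Matrix (HiggsLattice.Site P (i.j + 1) × Ix N) (HiggsLattice.Site P (i.j + 1) × Ix N) ℝ :=
  fun p q => if h : p.1 ∈ i.L6 ∧ q.1 ∈ i.L6 then M (⟨p.1, h.1⟩, p.2) (⟨q.1, h.2⟩, q.2) else 0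

/-- **The coordinate matrix of `H_k` on all of `T⁽ᵏ⁾ × {1,…,N}`**: g15's `Hk` on `X`, zero elsewhere.
[cite: Balaban1982Higgs2, (2.108) p.580] -/
def HkFull : Matrix (HiggsLattice.Site P (i.j + 1) × Ix N) (HiggsLattice.Site P (i.j + 1) × Ix N) ℝ :=
  extL6 i (i.Hk a)

/-- **`H_k` AS A LINEAR OPERATOR ON THE FIELDS OF `T⁽ᵏ⁾`** (the object print writes inside `½⟨Λ₆^{(k−1)′}φ, H_kΛ₆^{(k−1)′}φ⟩` in
(2.108), (3.5), (3.7)): the linear map whose coordinate matrix in p35's basis `cb` is `HkFull`.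
[cite: Balaban1982Higgs2, (2.108) p.580, (3.7) p.584] -/
def HkOp : ScalarField P (i.j + 1) N →ₗ[ℝ] ScalarField P (i.j + 1) N :=
  Matrix.toLin (cb P N (i.j + 1)) (cb P N (i.j + 1)) (HkFull i a)

/-- The coordinate matrix of `HkOp` is `HkFull`. [cite: Balaban1982Higgs2, (2.108) p.580] -/
theorem mat_HkOp : mat (HkOp i a) = HkFull i a := by
  rw [mat, HkOp, LinearMap.toMatrix_toLin]

/-- Entries of `HkFull` on `X`: g15's `Hk`. [cite: Balaban1982Higgs2, (2.108) p.580] -/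
theorem HkFull_apply_mem (p q : ↥i.L6 × Ix N) :
    HkFull i a ((p.1 : HiggsLattice.Site P (i.j + 1)), p.2) ((q.1 : HiggsLattice.Site P (i.j + 1)), q.2) = i.Hk a p q := by
  simp [HkFull, extL6, p.1.2, q.1.2]

/-- Entries of `HkFull` off `X` vanish (first index). [cite: Balaban1982Higgs2, (2.108) p.580] -/
theorem HkFull_apply_of_not_mem_left {p : HiggsLattice.Site P (i.j + 1) × Ix N} (hp : p.1 ∉ i.L6)
    (q : HiggsLattice.Site P (i.j + 1) × Ix N) : HkFull i a p q = 0 := by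
  simp only [HkFull, extL6]
  rw [dif_neg (fun h => hp h.1)]

/-- Entries of `HkFull` off `X` vanish (second index). [cite: Balaban1982Higgs2, (2.108) p.580] -/
theorem HkFull_apply_of_not_mem_right (p : HiggsLattice.Site P (i.j + 1) × Ix N)
    {q : HiggsLattice.Site P (i.j + 1) × Ix N} (hq : q.1 ∉ i.L6) : HkFull i a p q = 0 := by
  simp only [HkFull, extL6]
  rw [dif_neg (fun h => hq h.2)]

/-- **`⟨f, H_kg⟩ = (Lᵏε)ᵈ · Σ_{p,q∈X} f̂(p)·Hk(p,q)·ĝ(q)`** for ALL fields `f, g` on `T⁽ᵏ⁾` (`H_k` does not see the coordinates off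
`Λ₆^{(k−1)′}`). [cite: Balaban1982Higgs2, (2.108) p.580] [cite: Balaban1982Higgs1, (1.5) p.604] -/
theorem siteInner_HkOp (f g : ScalarField P (i.j + 1) N) :
    siteInner f (HkOp i a g)
      = P.mesh (i.j + 1) ^ P.d * ∑ p : ↥i.L6 × Ix N, ∑ q : ↥i.L6 × Ix N, crdL6 i f p * i.Hk a p q * crdL6 i g q := by
  classical
  rw [siteInner_eq_dotProduct, ← mat_mulVec, mat_HkOp]
  congr 1
  simp only [dotProduct, Matrix.mulVec, crdL6_apply]
  rw [sum_prod_eq_sum_sub i.L6 _ (fun p hp => by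
    simp [HkFull_apply_of_not_mem_left i a hp])]
  refine Finset.sum_congr rfl fun p _ => ?_
  rw [Finset.mul_sum]
  rw [sum_prod_eq_sum_sub i.L6 _ (fun q hq => by
    simp [HkFull_apply_of_not_mem_right i a _ hq])]
  refine Finset.sum_congr rfl fun q _ => ?_
  rw [HkFull_apply_mem]
  ring

/-- **The printed form `⟨Λ₆′φ, H_kΛ₆′φ⟩` IS g15's coordinate form** `(Lᵏε)ᵈ · (φ̂|_X ⬝ᵥ (Hk *ᵥ φ̂|_X))`.
[cite: Balaban1982Higgs2, (2.108) p.580, (3.7) p.584] -/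
theorem siteInner_cutTo_HkOp_cutTo (φ : ScalarField P (i.j + 1) N) :
    siteInner (cutTo i.L6 φ) (HkOp i a (cutTo i.L6 φ))
      = P.mesh (i.j + 1) ^ P.d * (crdL6 i φ ⬝ᵥ (i.Hk a *ᵥ crdL6 i φ)) := by
  classical
  rw [siteInner_HkOp]
  congr 1
  simp only [dotProduct, Matrix.mulVec, Finset.mul_sum, crdL6_apply, fieldCoord_cutTo_apply]
  refine Finset.sum_congr rfl fun p _ => Finset.sum_congr rfl fun q _ => ?_
  rw [if_pos p.1.2, if_pos q.1.2]
  ring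

/-! ## §3 (2.108) in the scalar-product currency (I.1.5) -/

/-- The full form: `⟨Λ₆′φ, Δ⁽ᵏ⁾(Ω,B̃)Λ₆′φ⟩ = (Lᵏε)ᵈ·(φ̂|_X ⬝ᵥ (MΩ *ᵥ φ̂|_X))`. [cite: Balaban1982Higgs2, (2.108) p.580] -/
theorem form_MΩ_eq (φ : ScalarField P (i.j + 1) N) :
    siteInner (cutTo i.L6 φ) (deltaKA i.C i.Ω i.A i.msq a (i.j + 1) (cutTo i.L6 φ))
      = P.mesh (i.j + 1) ^ P.d * (crdL6 i φ ⬝ᵥ (i.MΩ a *ᵥ crdL6 i φ)) := by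
  classical
  rw [siteInner_cutTo_op_cutTo i subset_rfl subset_rfl]
  congr 1
  simp only [dotProduct, Matrix.mulVec, Finset.mul_sum, Inst.MΩ, Inst.DΩ, Matrix.of_apply]
  refine Finset.sum_congr rfl fun p _ => Finset.sum_congr rfl fun q _ => ?_
  rw [if_pos p.1.2, if_pos q.1.2]
  ring

/-- The `P × P` form, `P = Λ₆′∖Λ₃`: `⟨Pφ, Δ⁽ᵏ⁾(Ω₁,B̃)Pφ⟩ = (Lᵏε)ᵈ·(φ̂|_X ⬝ᵥ (MPP *ᵥ φ̂|_X))`. [cite: Balaban1982Higgs2, (2.108) p.580] -/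
theorem form_MPP_eq (φ : ScalarField P (i.j + 1) N) :
    siteInner (cutTo (i.L6 \ i.L3) φ) (deltaKA i.C i.Ω₁ i.A i.msq a (i.j + 1) (cutTo (i.L6 \ i.L3) φ))
      = P.mesh (i.j + 1) ^ P.d * (crdL6 i φ ⬝ᵥ (i.MPP a *ᵥ crdL6 i φ)) := by
  classical
  rw [siteInner_cutTo_op_cutTo i Finset.sdiff_subset Finset.sdiff_subset]
  congr 1
  simp only [dotProduct, Matrix.mulVec, Finset.mul_sum, Inst.MPP, Inst.D1, Matrix.of_apply, Finset.mem_sdiff]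
  refine Finset.sum_congr rfl fun p _ => Finset.sum_congr rfl fun q _ => ?_
  by_cases hp : p.1.1 ∈ i.L3 <;> by_cases hq : q.1.1 ∈ i.L3 <;>
    simp [hp, hq, p.1.2, q.1.2, mul_comm, mul_left_comm]

/-- The cross form (right half): `⟨Pφ, Δ⁽ᵏ⁾(Ω₁,B̃)(Λ₃∖Λ₄)φ⟩ = (Lᵏε)ᵈ·(φ̂|_X ⬝ᵥ (MP34 *ᵥ φ̂|_X))`. [cite: Balaban1982Higgs2, (2.108) p.580] -/
theorem form_MP34_eq (φ : ScalarField P (i.j + 1) N) :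
    siteInner (cutTo (i.L6 \ i.L3) φ) (deltaKA i.C i.Ω₁ i.A i.msq a (i.j + 1) (cutTo (i.L3 \ i.L4) φ))
      = P.mesh (i.j + 1) ^ P.d * (crdL6 i φ ⬝ᵥ (i.MP34 a *ᵥ crdL6 i φ)) := by
  classical
  rw [siteInner_cutTo_op_cutTo i Finset.sdiff_subset (Finset.sdiff_subset.trans i.h36)]
  congr 1
  simp only [dotProduct, Matrix.mulVec, Finset.mul_sum, Inst.MP34, Inst.D1, Matrix.of_apply, Finset.mem_sdiff]
  refine Finset.sum_congr rfl fun p _ => Finset.sum_congr rfl fun q _ => ?_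
  by_cases hp : p.1.1 ∈ i.L3 <;> by_cases hq3 : q.1.1 ∈ i.L3 <;> by_cases hq4 : q.1.1 ∈ i.L4 <;>
    simp [hp, hq3, hq4, p.1.2, mul_comm, mul_left_comm]

/-- The `Λ₃ × Λ₃` form: `⟨Λ₃φ, Δ⁽ᵏ⁾(Ω₂,B̃)Λ₃φ⟩ = (Lᵏε)ᵈ·(φ̂|_X ⬝ᵥ (M33 *ᵥ φ̂|_X))`. [cite: Balaban1982Higgs2, (2.108) p.580] -/
theorem form_M33_eq (φ : ScalarField P (i.j + 1) N) :
    siteInner (cutTo i.L3 φ) (deltaKA i.C i.Ω₂ i.A i.msq a (i.j + 1) (cutTo i.L3 φ))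
      = P.mesh (i.j + 1) ^ P.d * (crdL6 i φ ⬝ᵥ (i.M33 a *ᵥ crdL6 i φ)) := by
  classical
  rw [siteInner_cutTo_op_cutTo i i.h36 i.h36]
  congr 1
  simp only [dotProduct, Matrix.mulVec, Finset.mul_sum, Inst.M33, Inst.D2, Matrix.of_apply]
  refine Finset.sum_congr rfl fun p _ => Finset.sum_congr rfl fun q _ => ?_
  by_cases hp : p.1.1 ∈ i.L3 <;> by_cases hq : q.1.1 ∈ i.L3 <;>
    simp [hp, hq, mul_comm, mul_left_comm]

/-- **(2.108) IN THE SCALAR-PRODUCT CURRENCY (I.1.5) OF THE CARRIER** (cross term once, as printed; halve for the printed `½`'s):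
`⟨Λ₆′φ, Δ⁽ᵏ⁾(Bᵏ(Λ₂′),B̃)Λ₆′φ⟩ = ⟨Pφ, Δ⁽ᵏ⁾(Ω₁,B̃)Pφ⟩ + 2⟨Pφ, Δ⁽ᵏ⁾(Ω₁,B̃)(Λ₃∖Λ₄)φ⟩ + ⟨Λ₃φ, Δ⁽ᵏ⁾(Ω₂,B̃)Λ₃φ⟩ + ⟨Λ₆′φ, H_kΛ₆′φ⟩`,
`P = Λ₆′∖Λ₃`, `Ω₁ = Bᵏ(Λ₂′∖Λ₅)`, `Ω₂ = Bᵏ(Λ₂^{(k)})` — g15's coordinate identity `eq2108_split_printed` transported by §1–§2.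
[cite: Balaban1982Higgs2, (2.108) p.580] -/
theorem eq2108_siteInner (φ : ScalarField P (i.j + 1) N) :
    siteInner (cutTo i.L6 φ) (deltaKA i.C i.Ω i.A i.msq a (i.j + 1) (cutTo i.L6 φ))
      = siteInner (cutTo (i.L6 \ i.L3) φ) (deltaKA i.C i.Ω₁ i.A i.msq a (i.j + 1) (cutTo (i.L6 \ i.L3) φ))
        + 2 * siteInner (cutTo (i.L6 \ i.L3) φ) (deltaKA i.C i.Ω₁ i.A i.msq a (i.j + 1) (cutTo (i.L3 \ i.L4) φ))
        + siteInner (cutTo i.L3 φ) (deltaKA i.C i.Ω₂ i.A i.msq a (i.j + 1) (cutTo i.L3 φ))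
        + siteInner (cutTo i.L6 φ) (HkOp i a (cutTo i.L6 φ)) := by
  rw [form_MΩ_eq, form_MPP_eq, form_MP34_eq, form_M33_eq, siteInner_cutTo_HkOp_cutTo, i.eq2108_split_printed a (crdL6 i φ)]
  ring

/-- **THE PRINTED HALVES — (3.5)'s three scalar operator lines versus (3.7)'s lines 4–5** (p. 584 *"we have applied formula
(2.108) … to the expression in the exponent in (3.5)"*):
`−½⟨Λ₆′φ, Δ⁽ᵏ⁾(Bᵏ(Λ₂′),B̃)Λ₆′φ⟩ + ½⟨Λ₆′φ, H_kΛ₆′φ⟩ = −½⟨Pφ, Δ⁽ᵏ⁾(Ω₁,B̃)Pφ⟩ − ⟨Pφ, Δ⁽ᵏ⁾(Ω₁,B̃)(Λ₃∖Λ₄)φ⟩ − ½⟨Λ₃φ, Δ⁽ᵏ⁾(Ω₂,B̃)Λ₃φ⟩`.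
[cite: Balaban1982Higgs2, (2.108) p.580, (3.5) p.583, (3.7) p.584] -/
theorem eq2108_siteInner_half (φ : ScalarField P (i.j + 1) N) :
    -(1 / 2 : ℝ) * siteInner (cutTo i.L6 φ) (deltaKA i.C i.Ω i.A i.msq a (i.j + 1) (cutTo i.L6 φ))
        + (1 / 2 : ℝ) * siteInner (cutTo i.L6 φ) (HkOp i a (cutTo i.L6 φ))
      = -(1 / 2 : ℝ) * siteInner (cutTo (i.L6 \ i.L3) φ) (deltaKA i.C i.Ω₁ i.A i.msq a (i.j + 1) (cutTo (i.L6 \ i.L3) φ))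
        - siteInner (cutTo (i.L6 \ i.L3) φ) (deltaKA i.C i.Ω₁ i.A i.msq a (i.j + 1) (cutTo (i.L3 \ i.L4) φ))
        - (1 / 2 : ℝ) * siteInner (cutTo i.L3 φ) (deltaKA i.C i.Ω₂ i.A i.msq a (i.j + 1) (cutTo i.L3 φ)) := by
  rw [eq2108_siteInner]
  ring

end Operator

end Literature.MathematicalPhysics.QuantumFieldTheory.Balaban1983to89.B2Eq2108HkOperator

end
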